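import Literature.MathematicalPhysics.QuantumFieldTheory.Balaban1983to89.Beta.RemainderHasMajGreenPrimeTowerDecayCoshClosed
import Literature.MathematicalPhysics.QuantumFieldTheory.Balaban1983to89.B9Eq326OperatorTowerRealityUnitary

/-!
# T. Bałaban, *Propagators for lattice gauge theories in a background field*, Commun. Math. Phys. **99** (1985) 389–434
# [Balaban1985BackgroundPropagators] Thm 3.1 (3.42) for `G′_k(U)` AS THE `hG`-SHAPED `HasMaj` OF ROW (D4) ON PRINT's SMALL-FIELD CLASS (3.35)–(3.36):
# `U(N)`-type values, bond variables `‖U(b) − 1‖ ≤ αη`, plaquette variables `‖U(∂p) − 1‖ ≤ αη²` — EVERYTHING ELSE DERIVED (the level profile (3.37)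
# of the averages `Ū^j` by the AREA count of [B7], their unitarity by [B7] Prop. 2, the transporter letters (T) ∕ `hRS` ∕ `hRlev`, the positivity of
# `Δ′_{a′,k}(U)`): `∃ (α₁, C, κ′)` BEFORE the height, the volume and the background, `HasMaj S_m S_m (G′_k(U)↾ℝ) (B⋆(d, a′, C, κ′)·e^{−(κ′∕d)dist})`

CITATION HEADER (lean-in-tree rule 2026-08-18).  Sources: [Balaban1985BackgroundPropagators] (B9; held
`paper:balaban1985-cmp99-background-propagators`, journal page = PDF page + 388): p. 397 Thm 3.1 (3.42); p. 396 (3.35) *«|U(∂p) − 1| < α₀η² … U with values in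
the unitary group»*, (3.36)–(3.37) (the smallness of `U` and of the averages `Ū^j`); (3.15) p. 393 (the level backgrounds of `Q_k(U)`); (3.24) p. 394; (3.49)
p. 399; p. 416 Thm 3.11 (positivity); [Balaban1985Averaging] (B7) (42)–(43) pp. 23–24, p. 25, Prop. 2 (52)–(54) p. 26, (18)–(19) p. 21, (22)–(23) p. 21;
[Balaban1985Variational] (B11) (180) p. 306, (190) p. 308; [Balaban1984PropagatorsII] (B6) (2.51)–(2.52) p. 232.

WHY THIS FILE (audit cell `pub-balaban`, BINDER row (D4), OWNER lineage `b2b-balaban-beta-an4`, gen 109; «Y3g»).  Y3f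
(`Beta.RemainderHasMajGreenPrimeTowerDecayCoshClosed.exists_hasMaj_GpOfUk_closed_unitary`) leaves displayed, on the chain's class, the STRUCTURAL letters
`hRlev` (contractive transporters of the level averages `Ū^j`), `U(b) ∈ U1`, `Ū^j(b) ∈ U1`, unitarity as `star U(b) = U(b)⁻¹`, and the LEVEL PROFILE (3.37)
`‖Ū^j(b) − 1‖ ≤ ε_j ≤ αr^j`.  On PRINT's class ALL of them are tree theorems: `B9Eq326OperatorTowerRealityUnitary.forall_star_eq_inv_of_mem` (`U⋆ = U⁻¹`),
`B7Prop2Explicit.unitaryUnits_le_U1` (`U ∈ U1`), `B7Eq43AveragedSmallnessLevelFree.UlevOf_mem` at the `AvgClosed` subgroup `unitaryUnits` (`Ū^j ∈ unitaryUnits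
⊆ U1`, via `pdev_perCfg_le_of_plaq`), `B9Eq342GreenPrimeSupBound.norm_adTransportW_eq` at the unitary `Ū^j` (`hRlev` with equality),
`B9Eq310HessianHermitian.adTransportW_adjoint` (`hRS`), `B7Eq43AveragedSmallnessLevelFree.exists_profile_of_windows_eta` (the profile (3.37) FROM the bond
and plaquette windows, level-free, `r = 1∕L`), `B9Thm311SitePrimeFormCoerciveTowerCanonical.exists_strong_site_coercive_tower_diagonal` (positivity).  THIS FILE
composes them:
* `levels_unitary_of_plaq` — in the torus plaquette window every level background is unitary: `Ū^j(b) ∈ unitaryUnits 𝔸` (the road of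
  `B9Eq326OperatorTowerRealityUnitary.UlevOf_star_eq_inv_of_plaq`);
* **`exists_hasMaj_GpOfUk_plaquette`** — `𝔸` a non-trivial C⋆-algebra (e.g. `M_N(ℂ)`, `G = U(N)`), `1 ≤ d`, `2 ≤ L`; `∃ α₁ C κ′` (`0 < α₁`, `0 ≤ C`, `0 < κ′`,
  `2κ′ < 1∕√(4d+1)`) such that at EVERY height `n` (diagonal `ηL^{n+1} = 1`, `c₀(L^{n+1})^d = c₁`), for EVERY period `m` and EVERY `unitaryUnits`-valued background
  `U` with `‖U(b) − 1‖ ≤ αη` and `‖U(∂p) − 1‖ ≤ αη²` for some `0 ≤ α ≤ α₁`: (i) `Δ′_{a′,k}(U)` is positive (a witness EXISTS — the statement is not vacuous)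
  and (ii) for ANY positivity witness and EVERY big-block family: `HasMaj S_m S_m ((e∘G′_k(U)∘e⁻¹)↾ℝ) (B⋆·e^{−(κ′∕d)·dist})`,
  `B⋆ = (1 + |a′|C)·2e^{1∕2}·Σ_{l<d}2^{l+1} + √(3^d·2^d)·√(2e^{1∕2}·K_d(1∕√(4d+1) − 2κ′))·C` — the ONLY displayed letters are print's (3.35)–(3.36) read
  GLOBALLY on the torus and the Hilbert-structure letters (`*`-trace `τ`, compatibility of the fibre norm `φ`).  Mechanism: Y3f's `…_closed_unitary` and the
  coercivity at `r := 1∕L`, with [B7] Prop. 2's numeric constant CHOSEN INSIDE as `2α⋆`, `α⋆ = min(1∕(6C₀), c₂′∕4, A∕(4K+1))`, `K = 256(d+1)(d+4)`,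
  `A = min(α₁′, α₀′)` (the two NE9 thresholds), the common smallness `α″ = α + 2Kα⋆ ≤ A`, threshold `α₁ := min(A∕2, α⋆)`.
[folklore] composition; no estimate of [5] proved here.

HONEST SCOPE.  [folklore] bookkeeping over NE9's letters ((D-E)_k, (D-P)_k, the coercivity and the area count ne9-leaf-03; row sum ∕ weights ∕
height-free arithmetic t4-ne9-p1; unitarity of the averages = the cell's [B7] Prop. 2 files); SITE operator `G′_k(U)` of Thm 3.1, NOT Thm 3.3's BOND operator
`Δ_a⁻¹` of NODE D (Sect. C random walk — the `Gaps/D4WalkBlock*` road; the NE9 OWNER's plan v11 storey G₁; memo `FLAT-LETTERS-LOCATED.md` §§19–20); the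
FINE-BOND window (3.36) is a hypothesis read GLOBALLY on the torus — it is NOT derived from the plaquette window (non-contractible holonomies; print's (3.35) is
a PER-CUBE gauge statement, Lemma 3.1 ∕ [B7] (44)–(47) — «the gauge question», exactly as in the cell's `…TwoWindows` files); constants = the chain's window
sizes through `(α₁′, α₀′, C, κ′)`, not print's `δ₀, B₀`; VALUE row only.  Nothing identifies Bałaban's step objects (NODE O).  Row (D4) class UNCHANGED
(instance 0∕1; D4 DISCHARGE NO DATE); NOT B12 Thm 2, NOT BetaPertH, NOT continuum, NOT Clay.  HONEST DEPENDENCY (cell line): continuum YM on T⁴ ⇐ BetaPertH ∧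
nine spine estimates (0/9 proved); BetaPertH ⇐ (D1) ∧ (D4) ∧ CAP+tail; G-an2-4 gates asym, D1 and NE2/3/4.  NEW file importing Y3f and
`B9Eq326OperatorTowerRealityUnitary` (whose cone holds `B7Eq43AveragedSmallnessLevelFree`); nothing modified; 0 `def`; standard axioms; no `sorry`.
-/

noncomputable section

open scoped BigOperators InnerProductSpace

namespace Literature.MathematicalPhysics.QuantumFieldTheory.Balaban1983to89.Beta.RemainderHasMajGreenPrimeTowerDecayCoshPlaquette

open B11SectG B11SupSize190
open B4Sect5Torus (TSite tdist)
open B4Sect5Proof (latticeConst latticeConst_nonneg)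
open B5TorusCover (UT)
open B7Prop1Explicit (U1)
open B7Prop2Explicit (pdev C0 c2' C0_pos c2'_pos unitaryUnits avgClosed_unitaryUnits unitaryUnits_le_U1)
open B7Eq43AveragedSmallnessLevelFree (UlevOf_mem pdev_perCfg_le_of_plaq exists_profile_of_windows_eta)
open B9Thm34Ext (toB6)
open B9Thm37GlueTorus (torusGeom)
open B9SectCLatticeCarrier (Bond)
open B9Eq310DeltaPrime (plaqHolU)
open B9Eq311L2Pairing (WL2)
open B9Eq319QprimeTorus (fineP blockCoord)
open B9Eq315QTorus (perCfg)
open B9Eq315QTower (towerP towerP_apply UlevOf)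
open B9Eq316TowerFlatIsOneStep (towerP_eq_fineP_pow siteCast)
open B9Eq310HessianOperator (adTransportW)
open B9Eq310HessianHermitian (adTransportW_adjoint)
open B11Eq103H1Complex (covDerivL2K)
open B11Eq103H1Complex (SiteL2K covLaplaceSiteK)
open B9Eq324DeltaPrimeATower (laplacePrimeAk GpOfUk)
open B9Thm311SitePrimeFormCoerciveTowerCanonical (exists_strong_site_coercive_tower_diagonal)
open B9Eq342GreenPrimeSupBound (norm_adTransportW_eq)
open B9Eq326OperatorTowerRealityUnitary (star_val_eq_inv_of_mem_unitaryUnits forall_star_eq_inv_of_mem)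
open Beta.RemainderHasMajGreenPrimeTowerDecayCoshClosed (exists_hasMaj_GpOfUk_closed_unitary)

/-! ## §1 The level backgrounds of a unitary small-plaquette tower are unitary (torus window) -/

section Levels

variable {d : ℕ} (L : ℕ) [NeZero L] (m : Fin d → ℕ) [∀ i, NeZero (m i)] (n : ℕ)
  {𝔸 : Type*} [CStarAlgebra 𝔸] [Nontrivial 𝔸] (hL : 2 ≤ L)
  {U : Bond d (towerP L m (n + 1)) → 𝔸ˣ} (hU : ∀ b, U b ∈ unitaryUnits 𝔸)
  {α₀ : ℝ} (hα : 0 < α₀) (hα3 : C0 d * α₀ ≤ 1 / 3) (hα2 : 2 * α₀ ≤ c2' d L)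

include hL hU hα hα3 hα2 in
/-- **IN THE TORUS PLAQUETTE WINDOW EVERY LEVEL BACKGROUND IS UNITARY**: `‖U(∂p) − 1‖ ≤ α_pη²` on the diagonal `ηL^{n+1} = 1` with `0 ≤ α_p < α₀` ⟹
`Ū^j(b) ∈ unitaryUnits 𝔸` for every level `j` and bond `b` (`pdev_perCfg_le_of_plaq` ⟹ Prop. 2's `h52` ⟹ `UlevOf_mem` at `unitaryUnits`).
[cite: Balaban1985Averaging, Prop. 2 (52)–(54) p.26, (42) p.23, (22)–(23) p.21] [cite: Balaban1985BackgroundPropagators, (3.35) p.396, (3.15) p.393] -/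
theorem levels_unitary_of_plaq {η αp : ℝ} (hηL : η * (L : ℝ) ^ (n + 1) = 1) (hαp0 : 0 ≤ αp) (hαp : αp < α₀)
    (hpl : ∀ p : B9SectCLatticeCarrier.Plaq d (towerP L m (n + 1)), ‖(plaqHolU U p : 𝔸) - 1‖ ≤ αp * η ^ 2)
    (j : ℕ) (b : Bond d (towerP L m (j + 1))) : UlevOf L m (n + 1) U j b ∈ unitaryUnits 𝔸 := by
  have hU1 : ∀ b, U b ∈ U1 𝔸 := fun b => unitaryUnits_le_U1 (hU b)
  have hLpos : (0 : ℝ) < (L : ℝ) ^ (n + 1) := pow_pos (by exact_mod_cast (show 0 < L by omega)) _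
  have hη : η = ((L : ℝ) ^ (n + 1))⁻¹ := by
    field_simp
    linarith [hηL]
  have hpd : pdev (perCfg (towerP L m (n + 1)) U) ≤ αp * η ^ 2 :=
    pdev_perCfg_le_of_plaq (U := U) hU1 (mul_nonneg hαp0 (sq_nonneg η)) hpl
  have h52 : pdev (perCfg (towerP L m (n + 1)) U) < α₀ * (((L : ℝ) ^ (n + 1))⁻¹) ^ 2 := by
    rw [← hη]
    have hη2 : 0 < η ^ 2 := by rw [hη]; positivity
    exact hpd.trans_lt (mul_lt_mul_of_pos_right hαp hη2)
  exact UlevOf_mem L m n hL (avgClosed_unitaryUnits d L) hU hα hα3 hα2 h52 j b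

end Levels

/-! ## §2 The `hG` shape on print's class (3.35)–(3.36): unitary values, small bond variables `αη`, small plaquettes `αη²` — the level profile (3.37),
the `U1`-memberships, `hRS`, (T), `hRlev` and [B7] Prop. 2's numeric window ALL derived -/

section Plaquette

variable {d : ℕ} (L : ℕ) [NeZero L] {𝔸 : Type*} [CStarAlgebra 𝔸] [Nontrivial 𝔸]
  {W : Type} [NormedAddCommGroup W] [InnerProductSpace ℂ W] [FiniteDimensional ℂ W] (φ : W ≃ₗ[ℂ] 𝔸) {a' Mφ Mφ' : ℝ}
  (hMφ : 0 ≤ Mφ) (hMφ' : 0 ≤ Mφ') (hφ : ∀ w, ‖φ w‖ ≤ Mφ * ‖w‖) (hφ' : ∀ X, ‖φ.symm X‖ ≤ Mφ' * ‖X‖) (ha' : 0 < a')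
  (τ : 𝔸 →ₗ[ℂ] ℂ) (hτ₂ : ∀ X Y : 𝔸, τ (X * Y) = τ (Y * X)) (hφτ : ∀ X Y : 𝔸, ⟪φ.symm X, φ.symm Y⟫_ℂ = τ (star X * Y))

include hMφ hMφ' hφ hφ' ha' hτ₂ hφτ in
/-- **[5] THM 3.1 (3.42) AT EVERY HEIGHT AS `HasMaj S_m S_m (G′_k(U)↾ℝ) (B⋆·e^{−(κ′∕d)·dist})` ON PRINT's SMALL-FIELD CLASS, `∃ (α₁, C, κ′)` BEFORE THE HEIGHT,
THE VOLUME AND THE BACKGROUND** (`1 ≤ d`, `2 ≤ L`; data `M_φ, M_φ′`, `a′ > 0`, a `*`-trace `τ` compatible with the fibre norm): there are `α₁, κ′ > 0`, `C ≥ 0`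
(`2κ′ < 1∕√(4d+1)`) such that at every height `n` on print's diagonal (`ηL^{n+1} = 1`, `c₀(L^{n+1})^d = c₁`), for every period `m` and every
`unitaryUnits`-valued background `U` in the TWO-WINDOW class — bond variables `‖U(b) − 1‖ ≤ αη` and plaquette variables `‖U(∂p) − 1‖ ≤ αη²` for some
`0 ≤ α ≤ α₁` — (i) `Δ′_{a′,k}(U)` IS POSITIVE (print's Thm 3.11 on the window: the cell's `exists_strong_site_coercive_tower_diagonal`; so a positivity
witness EXISTS and (ii) is not vacuous) and (ii) for ANY positivity witness and every big-block family `P`, in the (190) sup sizes over ANY torus geometry: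
`HasMaj S_m S_m ((e∘G′_k(U)∘e⁻¹)↾ℝ) (B⋆·e^{−(κ′∕d)·dist(y,v)})`, `B⋆ = (1 + |a′|C)·2e^{1∕2}·Σ_{l<d}2^{l+1} + √(3^d·2^d)·√(2e^{1∕2}·K_d(1∕√(4d+1) − 2κ′))·C`.
EVERY OTHER LETTER OF Y3f's `exists_hasMaj_GpOfUk_closed_unitary` IS DERIVED: the LEVEL PROFILE (3.37) `‖Ū^j(b) − 1‖ ≤ ε_j ≤ α″(1∕L)^j` by ne9-leaf-03's
`B7Eq43AveragedSmallnessLevelFree.exists_profile_of_windows_eta` (the AREA count, level-free; `r = 1∕L`, `α″ = α + 2·256(d+1)(d+4)·α⋆` with [B7] Prop. 2's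
numeric constant CHOSEN inside as `2α⋆`, `α⋆ = min(1∕(6C₀), c₂′∕4, min(α₁′, α₀′)∕(4·256(d+1)(d+4)))`), `Ū^j ∈ unitaryUnits ⊆ U1` (§1), `star U = U⁻¹`, `U ∈ U1`,
`hRS` (`adTransportW_adjoint`), (T) and `hRlev` (`norm_adTransportW_eq`).  What stays DISPLAYED is print's (3.35)–(3.36) read GLOBALLY on the torus (the
fine-bond window is NOT derived from the plaquette window: non-contractible holonomies — print's statement is per cube) + the Hilbert-structure letters.
[cite: Balaban1985BackgroundPropagators, Thm 3.1 (3.42) p.397, Thm 3.11 p.416, (3.35)–(3.37) p.396, (3.15) p.393, (3.24) p.394, (3.49) p.399]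
[cite: Balaban1985Averaging, Prop. 2 (52)–(54) p.26, (42)–(43) pp.23–24, (18)–(19) p.21] [cite: Balaban1985Variational, (180) p.306, (190) p.308]
[cite: Balaban1984PropagatorsII, (2.51)–(2.52) p.232] -/
theorem exists_hasMaj_GpOfUk_plaquette (hd : 1 ≤ d) (hL : 2 ≤ L) :
    ∃ α₁ C κ' : ℝ, 0 < α₁ ∧ 0 ≤ C ∧ 0 < κ' ∧ 2 * κ' < Real.sqrt (1 / (4 * d + 1)) ∧
      ∀ (n : ℕ) (η : ℝ), η * (L : ℝ) ^ (n + 1) = 1 →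
      ∀ (c₀ c₁ : ℝ) [Fact (0 < c₀)] [Fact (0 < c₁)], c₀ * ((L : ℝ) ^ (n + 1)) ^ d = c₁ →
      ∀ (m : Fin d → ℕ) [∀ i, NeZero (m i)] (U : Bond d (towerP L m (n + 1)) → 𝔸ˣ),
        (∀ b, U b ∈ unitaryUnits 𝔸) →
      ∀ (α : ℝ), 0 ≤ α → α ≤ α₁ → (∀ b, ‖(U b : 𝔸) - 1‖ ≤ α * η) →
        (∀ p : B9SectCLatticeCarrier.Plaq d (towerP L m (n + 1)), ‖(plaqHolU U p : 𝔸) - 1‖ ≤ α * η ^ 2) →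
      (∀ x : SiteL2K ℂ d (towerP L m (n + 1)) c₀ W, x ≠ 0 → 0 < RCLike.re ⟪x, laplacePrimeAk L m n φ η U a' (c₁ := c₁) x⟫_ℂ) ∧
      ∀ (hpos' : ∀ x : SiteL2K ℂ d (towerP L m (n + 1)) c₀ W, x ≠ 0 → 0 < RCLike.re ⟪x, laplacePrimeAk L m n φ η U a' (c₁ := c₁) x⟫_ℂ)
        (PS : TSite d m → SiteL2K ℂ d (towerP L m (n + 1)) c₀ W →L[ℂ] SiteL2K ℂ d (towerP L m (n + 1)) c₀ W),
        (∀ (y : TSite d m) (f : SiteL2K ℂ d (towerP L m (n + 1)) c₀ W) (x : TSite d (towerP L m (n + 1))),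
          WL2.equiv ℂ (fun _ : TSite d (towerP L m (n + 1)) => c₀) W (PS y f) x =
            if blockCoord (L ^ (n + 1)) m (siteCast (towerP_eq_fineP_pow L m (n + 1)) x) = y then
              WL2.equiv ℂ (fun _ : TSite d (towerP L m (n + 1)) => c₀) W f x else 0) →
      ∀ (η₀ L₀ M₀ R : ℝ) (H : Prop),
        HasMaj
          (supSize (toB6 (torusGeom m η₀ L₀ M₀) R H)
            (fun y => Finset.univ.filter fun x : TSite d (towerP L m (n + 1)) =>
              blockCoord (L ^ (n + 1)) m (siteCast (towerP_eq_fineP_pow L m (n + 1)) x) = UT.toSite m y)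
            (fun x => UT.ofSite m (blockCoord (L ^ (n + 1)) m (siteCast (towerP_eq_fineP_pow L m (n + 1)) x))) :
              BlockNorm (toB6 (torusGeom m η₀ L₀ M₀) R H) (TSite d (towerP L m (n + 1)) → W))
          (supSize (toB6 (torusGeom m η₀ L₀ M₀) R H)
            (fun y => Finset.univ.filter fun x : TSite d (towerP L m (n + 1)) =>
              blockCoord (L ^ (n + 1)) m (siteCast (towerP_eq_fineP_pow L m (n + 1)) x) = UT.toSite m y)
            (fun x => UT.ofSite m (blockCoord (L ^ (n + 1)) m (siteCast (towerP_eq_fineP_pow L m (n + 1)) x))))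
          (((LinearMap.toContinuousLinearMap
              ((WL2.linearEquiv ℂ ℂ (fun _ : TSite d (towerP L m (n + 1)) => c₀) :
                  SiteL2K ℂ d (towerP L m (n + 1)) c₀ W ≃ₗ[ℂ] (TSite d (towerP L m (n + 1)) → W)).toLinearMap ∘ₗ
                GpOfUk L m n φ η U a' (c₁ := c₁) hpos' ∘ₗ
                (WL2.linearEquiv ℂ ℂ (fun _ : TSite d (towerP L m (n + 1)) => c₀) :
                  SiteL2K ℂ d (towerP L m (n + 1)) c₀ W ≃ₗ[ℂ] (TSite d (towerP L m (n + 1)) → W)).symm.toLinearMap)).restrictScalars ℝ :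
              (TSite d (towerP L m (n + 1)) → W) →ₗ[ℝ] (TSite d (towerP L m (n + 1)) → W)))
          (fun y v => ((1 + |a'| * C) * (Real.exp (1 / 2) * 2) * (∑ l ∈ Finset.range d, (2 : ℝ) ^ (l + 1)) +
              Real.sqrt (3 ^ d * 2 ^ d) * Real.sqrt ((Real.exp (1 / 2) * 2) * latticeConst d (Real.sqrt (1 / (4 * d + 1)) - 2 * κ')) * C) *
            Real.exp (-(κ' / d * (toB6 (torusGeom m η₀ L₀ M₀) R H).dist y v))) := by
  have hL1 : (1 : ℝ) ≤ L := by exact_mod_cast (le_trans (by norm_num) hL : 1 ≤ L)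
  have hL0 : (0 : ℝ) < L := lt_of_lt_of_le one_pos hL1
  have hr0 : (0 : ℝ) ≤ 1 / (L : ℝ) := by positivity
  have hr1 : 1 / (L : ℝ) < 1 := by
    rw [div_lt_one hL0]; exact_mod_cast (lt_of_lt_of_le (by norm_num) hL : 1 < L)
  obtain ⟨α₁', C, κ', hα₁', hC, hκ'0, h2κ, hAll⟩ :=
    exists_hasMaj_GpOfUk_closed_unitary L φ (a' := a') hMφ hMφ' hφ hφ' ha' hr0 hr1 τ hτ₂ hφτ hd
  -- print's Thm 3.11 positivity on the same window (the cell's theorem): the witness EXISTS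
  obtain ⟨α₀', γ', hα₀', hγ', hcoer⟩ :=
    exists_strong_site_coercive_tower_diagonal L φ (a' := a') hMφ hMφ' hφ hφ' ha' hr0 hr1
  -- the constants: [B7] Prop. 2's numeric window chosen inside (`2α⋆`), the common threshold `A`, the profile slack `K`
  obtain ⟨K, hK0, hKdef⟩ : ∃ K : ℝ, 0 ≤ K ∧ K = 256 * ((d : ℝ) + 1) * (d + 4) := ⟨_, by positivity, rfl⟩
  obtain ⟨A, hA0, hAdef⟩ : ∃ A : ℝ, 0 < A ∧ A = min α₁' α₀' := ⟨_, lt_min hα₁' hα₀', rfl⟩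
  have hC0 : 0 < C0 d := C0_pos d
  have hc2 : 0 < c2' d L := c2'_pos d L (le_trans (by norm_num) hL)
  obtain ⟨αs, hαs0, hαsdef⟩ : ∃ αs : ℝ, 0 < αs ∧ αs = min (min (1 / (6 * C0 d)) (c2' d L / 4)) (A / (4 * K + 1)) :=
    ⟨_, lt_min (lt_min (by positivity) (by positivity)) (by positivity), rfl⟩
  have hαs1 : αs ≤ 1 / (6 * C0 d) := by rw [hαsdef]; exact (min_le_left _ _).trans (min_le_left _ _)
  have hαs2 : αs ≤ c2' d L / 4 := by rw [hαsdef]; exact (min_le_left _ _).trans (min_le_right _ _)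
  have hαs3 : αs ≤ A / (4 * K + 1) := by rw [hαsdef]; exact min_le_right _ _
  -- [B7] Prop. 2's window at `αP := 2α⋆`
  have hαP : 0 < 2 * αs := by positivity
  have hαP3 : C0 d * (2 * αs) ≤ 1 / 3 := by
    have hC0ne : C0 d ≠ 0 := hC0.ne'
    have h1 : C0 d * αs ≤ C0 d * (1 / (6 * C0 d)) := mul_le_mul_of_nonneg_left hαs1 hC0.le
    have h2 : C0 d * (1 / (6 * C0 d)) = 1 / 6 := by field_simp
    linarith
  have hαP2 : 2 * (2 * αs) ≤ c2' d L := by nlinarith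
  refine ⟨min (A / 2) αs, C, κ', lt_min (by positivity) hαs0, hC, hκ'0, h2κ, ?_⟩
  intro n η hηL c₀ c₁ _ _ hdiag m _ U hUu α hα0 hαle hUε hpl
  have hαA : α ≤ A / 2 := hαle.trans (min_le_left _ _)
  have hααs : α ≤ αs := hαle.trans (min_le_right _ _)
  have hαlt : α < 2 * αs := by linarith
  have hηpos : 0 < η := by
    have hN : (0 : ℝ) < (L : ℝ) ^ (n + 1) := pow_pos hL0 _
    have : η = ((L : ℝ) ^ (n + 1))⁻¹ := (inv_eq_of_mul_eq_one_left hηL).symm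
    rw [this]; positivity
  -- print's class: `U⋆ = U⁻¹`, `U ∈ U1`, `hRS`, the level averages unitary hence in `U1` with norm-preserving transporters
  have hUst : ∀ b, star (U b : 𝔸) = ((U b)⁻¹ : 𝔸ˣ) := forall_star_eq_inv_of_mem hUu
  have hUb : ∀ b, U b ∈ U1 𝔸 := fun b => unitaryUnits_le_U1 (hUu b)
  have hRS : ∀ (b : Bond d (towerP L m (n + 1))) (v u : W), ⟪adTransportW φ U b v, u⟫_ℂ = ⟪v, adTransportW φ (fun b => (U b)⁻¹) b u⟫_ℂ :=
    adTransportW_adjoint φ τ hτ₂ hUst hφτ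
  have hLu : ∀ (j : ℕ) (b : Bond d (towerP L m (j + 1))), UlevOf L m (n + 1) U j b ∈ unitaryUnits 𝔸 :=
    levels_unitary_of_plaq L m n hL hUu hαP hαP3 hαP2 hηL hα0 hαlt hpl
  have hLb : ∀ (j : ℕ) (b : Bond d (towerP L m (j + 1))), UlevOf L m (n + 1) U j b ∈ U1 𝔸 := fun j b => unitaryUnits_le_U1 (hLu j b)
  have hRlev : ∀ (j : ℕ) (b : Bond d (towerP L m (j + 1))) (w : W), ‖adTransportW φ (UlevOf L m (n + 1) U j) b w‖ ≤ ‖w‖ := fun j b w =>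
    (norm_adTransportW_eq φ (UlevOf L m (n + 1) U j) τ hτ₂ (fun b => star_val_eq_inv_of_mem_unitaryUnits (hLu j b)) hφτ b w).le
  -- the level profile (3.37) from the two windows (ne9-leaf-03's AREA count), `r = 1∕L`
  obtain ⟨εU, hεU, hLε, hεg⟩ :=
    exists_profile_of_windows_eta L m n hL (avgClosed_unitaryUnits d L) hUu hαP hαP3 hαP2 hηL hα0 hαlt hUε hpl
  -- the common smallness `α″ = α + 2Kα⋆ ≤ A`
  have hKαs : (4 * K + 1) * αs ≤ A := by
    have h := mul_le_mul_of_nonneg_left hαs3 (by positivity : (0 : ℝ) ≤ 4 * K + 1)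
    rwa [mul_div_cancel₀ _ (by positivity : (4 * K + 1 : ℝ) ≠ 0)] at h
  have hα''A : α + 2 * K * αs ≤ A := by nlinarith
  have hα''0 : 0 ≤ α + 2 * K * αs := by positivity
  have hα''1 : α + 2 * K * αs ≤ α₁' := hα''A.trans (by rw [hAdef]; exact min_le_left _ _)
  have hα''0' : α + 2 * K * αs ≤ α₀' := hα''A.trans (by rw [hAdef]; exact min_le_right _ _)
  have hUε'' : ∀ b, ‖(U b : 𝔸) - 1‖ ≤ (α + 2 * K * αs) * η := fun b =>
    (hUε b).trans (mul_le_mul_of_nonneg_right (by nlinarith) hηpos.le)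
  have hεg'' : ∀ j < n + 1, εU j ≤ (α + 2 * K * αs) * (1 / (L : ℝ)) ^ j := fun j hj => by
    refine (hεg j hj).trans (mul_le_mul_of_nonneg_right ?_ (by positivity))
    rw [hKdef, div_le_iff₀ hL0]
    have hnum : 0 ≤ α + 256 * ((d : ℝ) + 1) * (d + 4) * (2 * αs) := by positivity
    nlinarith
  refine ⟨fun x hx => ?_, fun hpos' PS hPS η₀ L₀ M₀ R H =>
    hAll n η hηL c₀ c₁ hdiag m U hUst (α + 2 * K * αs) hα''0 hα''1 hUb hUε'' εU hεU hεg'' hLε hLb hRlev hpos' PS hPS η₀ L₀ M₀ R H⟩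
  have key := hcoer n η hηL c₀ c₁ hdiag m U hRS (α + 2 * K * αs) hα''0 hα''0' hUb hUε'' εU hεU hεg'' hLε hLb x
  have hx2 : 0 < ‖x‖ ^ 2 := by positivity
  have hpos : 0 < γ' * (‖covDerivL2K ℂ c₀ ((η : ℂ))⁻¹ (adTransportW φ (fun _ : Bond d (towerP L m (n + 1)) => (1 : 𝔸ˣ))) x‖ ^ 2 + ‖x‖ ^ 2) :=
    mul_pos hγ' (add_pos_of_nonneg_of_pos (sq_nonneg _) hx2)
  exact hpos.trans_le key

end Plaquette

end Literature.MathematicalPhysics.QuantumFieldTheory.Balaban1983to89.Beta.RemainderHasMajGreenPrimeTowerDecayCoshPlaquette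

end
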